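import Mathlib
import Literature.Computability.Complexity.CliqueTestGraphs
import Summits.PneNP.PneNP.Theorems.ConvexRankGatesConvexGateBlindJuntaHard
import Summits.PneNP.PneNP.Theorems.ConvexRankGatesConvexGateBlindSymmetricBlind
import Literature.NumberTheory.Primality.SmoothNumbersLowerBound

/-!
# PneNP / ConvexRankGates — `ConvexGateBlind`: the SYMMETRIC LP slice of the canonical form of the crux holds (every `δ < 1/2`)

Helpers (`--supports stmt-PneNP-10680`), the asymptotic corollary of `…SymmetricBlind.lean` in the currency of the
canonical form of the crux (`convexGateBlind_iff_cliqueDistConeRankHard`, LP slice `q = 0`): the crux asks that for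
some `δ ∈ (0,1/2)` and every `c`, eventually in `m`, for every `ε > 0`, there be no non-negative `U, V` with `≤ m^c`
terms and `cdist Q u - ε = ∑_l U_{u,l} V_{l,Q}` for all `k`-sets `Q` (`k = ⌈m^δ⌉₊`) and all `k`-clique-free `u`.
THEOREM (`symmetric_cliqueDistConeRankHard`, registered stub `symmetric_crux`): for EVERY `δ ∈ (0,1/2)` and every
`c`, eventually in `m`, for every `ε > 0`, this already fails for all families of ROW objects `(V_l)_{l ∈ L}`,
`#L ≤ m^c`, that are `Sym(m)`-SYMMETRIC — every vertex permutation `σ` is compensated by a relabelling `τ σ` of the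
terms, `V_{τ σ l}(σ Q) = V_l(Q)`, as for the row side of any Yannakakis-symmetric monotone LP / symmetric non-negative
factorisation. So the symmetric LP slice of the crux is TRUE, unconditionally and in the crux's own quantifier order
(`m` first, then all `ε > 0`). In fact symmetry on the first `k² = ⌈m^δ⌉₊²` vertices already suffices
(`symmetric_cliqueDistConeRankHard_local`, stub `symmetric_crux_local`): a polynomial-size monotone LP certificate family for
`CLIQUE(m, m^δ)` must break the symmetry of every `m^{2δ}`-subset of the vertices. Proof: colour the block of the first
`(k-1)(k+1)` vertices with `k-1` classes of size `k+1` (`balCol` of `…JuntaHard.lean`), transport the family and the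
`Sym`-action along the embedding (`Equiv.Perm.extendDomain`, which fixes the rest), and apply
`cdist_colorVec_not_symmetricRep` with `t = ⌊(k-1)/2⌋`: `m^c ≤ k^{⌈1/δ⌉c} < (k+1)^{t+1} ≤ C(k²-1, t+1)` eventually. (The PSD half has no symmetric analogue: the theta certificate is
symmetric of size `m + 1`, `…ColouringTheta.lean`.) [new]
-/

set_option linter.dupNamespace false

namespace Summit.PneNP.PneNP.Theorems

open Finset Filter Literature.Computability.Complexity
open Summit.PneNP.PneNP.Cruxes.ConvexGateBlind.StrictRankConicCover (Edge cdist padRow padCol liveEmb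
  cdist_pad cliqueFn_padCol card_padRow)

noncomputable section

/-! ## Eventually the sizes fit -/

/-- For `0 < δ < 1/2` and any `B`: eventually `B ≤ ⌈m^δ⌉₊` and `⌈m^δ⌉₊ · ⌈m^δ⌉₊ ≤ m`. -/
theorem eventually_ceil_rpow_ge_and_sq_le {δ : ℝ} (hδ0 : 0 < δ) (hδ : δ < 1 / 2) (B : ℕ) :
    ∀ᶠ m : ℕ in atTop, B ≤ ⌈(m : ℝ) ^ δ⌉₊ ∧ ⌈(m : ℝ) ^ δ⌉₊ * ⌈(m : ℝ) ^ δ⌉₊ ≤ m := by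
  have hx : Tendsto (fun m : ℕ => (m : ℝ) ^ δ) atTop atTop :=
    (tendsto_rpow_atTop hδ0).comp tendsto_natCast_atTop_atTop
  have hceil : Tendsto (fun m : ℕ => ⌈(m : ℝ) ^ δ⌉₊) atTop atTop := tendsto_nat_ceil_atTop.comp hx
  filter_upwards [hceil.eventually_ge_atTop B, eventually_ceil_rpow_sq_le hδ0 hδ] with m hB hsq
  exact ⟨hB, hsq.2⟩

/-- For `0 < δ`: eventually `m ≤ ⌈m^δ⌉₊ ^ ⌈1/δ⌉₊` (i.e. `k = ⌈m^δ⌉₊ ≥ m^δ`, as a polynomial bound on `m` in terms of `k`). -/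
theorem eventually_le_ceil_rpow_pow {δ : ℝ} (hδ0 : 0 < δ) :
    ∀ᶠ m : ℕ in atTop, m ≤ ⌈(m : ℝ) ^ δ⌉₊ ^ ⌈1 / δ⌉₊ := by
  filter_upwards [eventually_ge_atTop 1] with m hm1
  have hm0 : (0 : ℝ) ≤ m := Nat.cast_nonneg _
  have hN₀ : 1 / δ ≤ (⌈1 / δ⌉₊ : ℝ) := Nat.le_ceil _
  have hx : (m : ℝ) ^ δ ≤ ⌈(m : ℝ) ^ δ⌉₊ := Nat.le_ceil _
  have hk1 : (1 : ℝ) ≤ ⌈(m : ℝ) ^ δ⌉₊ := by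
    have : (1 : ℝ) ≤ (m : ℝ) ^ δ := Real.one_le_rpow (by exact_mod_cast hm1) hδ0.le
    linarith
  have key : (m : ℝ) ≤ (⌈(m : ℝ) ^ δ⌉₊ : ℝ) ^ ((⌈1 / δ⌉₊ : ℕ) : ℝ) := by
    calc (m : ℝ) = ((m : ℝ) ^ δ) ^ (1 / δ) := by
          rw [← Real.rpow_mul hm0, mul_one_div_cancel hδ0.ne', Real.rpow_one]
      _ ≤ (⌈(m : ℝ) ^ δ⌉₊ : ℝ) ^ (1 / δ) := Real.rpow_le_rpow (by positivity) hx (by positivity)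
      _ ≤ (⌈(m : ℝ) ^ δ⌉₊ : ℝ) ^ ((⌈1 / δ⌉₊ : ℕ) : ℝ) := Real.rpow_le_rpow_of_exponent_le hk1 hN₀
  rw [Real.rpow_natCast] at key
  exact_mod_cast key

/-! ## Transporting a symmetric family to the coloured block -/

open Classical in
/-- The extension of a block permutation `σ` of `Fin M` to `Fin m` along the block embedding
(`σ.extendDomain (Equiv.ofInjective ι)`, identity off the block) acts as `σ` on the block. [folklore] -/
theorem extendDomain_apply_liveEmb {M m : ℕ} (h : M + 0 ≤ m) (σ : Equiv.Perm (Fin M)) (v : Fin M) :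
    σ.extendDomain (Equiv.ofInjective (liveEmb h) (liveEmb h).injective) (liveEmb h v) = liveEmb h (σ v) := by
  have := Equiv.Perm.extendDomain_apply_image σ (Equiv.ofInjective (liveEmb h) (liveEmb h).injective) v
  simpa using this

open Classical in
/-- The extension fixes every vertex off the block. [folklore] -/
theorem extendDomain_apply_of_le {M m : ℕ} (h : M + 0 ≤ m) (σ : Equiv.Perm (Fin M)) {v : Fin m} (hv : M ≤ v.val) :
    σ.extendDomain (Equiv.ofInjective (liveEmb h) (liveEmb h).injective) v = v := by
  refine Equiv.Perm.extendDomain_apply_not_subtype σ (Equiv.ofInjective (liveEmb h) (liveEmb h).injective) ?_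
  rintro ⟨w, hw⟩
  have : (liveEmb h w).val = w.val := rfl
  have hlt : (liveEmb h w).val < M := by rw [this]; exact w.isLt
  rw [hw] at hlt
  omega

open Classical in
/-- Naturality: embedding after `σ` = the extension after embedding, on sets. [folklore] -/
theorem map_map_extendDomain {M m : ℕ} (h : M + 0 ≤ m) (σ : Equiv.Perm (Fin M)) (P : Finset (Fin M)) :
    (P.map σ.toEmbedding).map (liveEmb h) =
      (P.map (liveEmb h)).map (σ.extendDomain (Equiv.ofInjective (liveEmb h) (liveEmb h).injective)).toEmbedding := by
  rw [Finset.map_map, Finset.map_map]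
  congr 1
  exact Function.Embedding.ext fun v => by
    simp only [Function.Embedding.trans_apply, Equiv.coe_toEmbedding]
    exact (extendDomain_apply_liveEmb h σ v).symm

/-! ## The symmetric LP slice of the canonical form holds — already for families symmetric on `k²` vertices -/

/-- **The LP slice of the crux holds for every family of row objects that is symmetric on the first `k²` vertices
(every `δ ∈ (0,1/2)`, every `c`).** Eventually in `m` (`k = ⌈m^δ⌉₊`), for every `ε > 0`, every index type `L` with
`#L ≤ m^c`, every `U ≥ 0`, and every family `(V_l)_{l ∈ L}` of non-negative row objects that is symmetric under the vertex
permutations FIXING EVERY VERTEX `v ≥ k²` (`V_{τ σ l}(σ Q) = V_l(Q)` for those `σ`), the canonical identity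
`cdist Q u - ε = ∑_l U_{u,l} V_l(Q)` fails for some `k`-set `Q` and some `k`-clique-free `u`. So a polynomial-size monotone LP
certificate family for `CLIQUE(m, m^δ)` must break the symmetry of EVERY set of `k² = m^{2δ}` vertices. Proof: colour the block of
the first `(k-1)(k+1) = k² - 1` vertices with `k - 1` classes of size `k + 1`, transport the family and the symmetry along the
block embedding (`Equiv.Perm.extendDomain`, which fixes the rest), and apply `cdist_colorVec_not_symmetricRep` with `t = ⌊(k-1)/2⌋`:
`m^c ≤ k^{⌈1/δ⌉ c} < (k+1)^{t+1} ≤ C((k+1)(t+1), t+1) ≤ C(k² - 1, t+1)`. [new] -/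
theorem symmetric_cliqueDistConeRankHard_local {δ : ℝ} (hδ0 : 0 < δ) (hδ : δ < 1 / 2) (c : ℕ) :
    ∀ᶠ m : ℕ in atTop, ∀ ε : ℝ, 0 < ε → ∀ (L : Type) [Fintype L], Fintype.card L ≤ m ^ c →
      ∀ (U : (Edge m → Bool) → L → ℝ) (V : L → Finset (Fin m) → ℝ) (τ : Equiv.Perm (Fin m) → L → L),
      (∀ σ : Equiv.Perm (Fin m), (∀ v : Fin m, ⌈(m : ℝ) ^ δ⌉₊ * ⌈(m : ℝ) ^ δ⌉₊ ≤ v.val → σ v = v) →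
        ∀ l Q, V (τ σ l) (Q.map σ.toEmbedding) = V l Q) →
      (∀ u l, 0 ≤ U u l) → (∀ l Q, 0 ≤ V l Q) →
      ¬ ∀ (Q : Finset (Fin m)) (u : Edge m → Bool), Q.card = ⌈(m : ℝ) ^ δ⌉₊ → cliqueFn m ⌈(m : ℝ) ^ δ⌉₊ u = false →
          cdist Q u - ε = ∑ l, U u l * V l Q := by
  set N₀ : ℕ := ⌈1 / δ⌉₊ with hN₀
  filter_upwards [eventually_ceil_rpow_ge_and_sq_le hδ0 hδ (2 * (N₀ * c) + 8), eventually_le_ceil_rpow_pow hδ0]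
    with m hm hmk
  obtain ⟨hkB, hkk⟩ := hm
  intro ε hε L _ hL U V τ hτ hU hV hall
  classical
  -- sizes: `k = K + 1`, `t = ⌊K/2⌋`, classes of size `k + 1`, block `M = K (k+1) = k² - 1 ≤ k² ≤ m`
  set k : ℕ := ⌈(m : ℝ) ^ δ⌉₊ with hk
  have hk8 : 8 ≤ k := by omega
  set K : ℕ := k - 1 with hK
  have hkK : k = K + 1 := by omega
  have hK2 : 2 ≤ K := by omega
  set M : ℕ := K * (k + 1) with hM
  have hMkk : M + 1 = k * k := by
    rw [hM, hkK]; ring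
  have hMle : M ≤ m := by omega
  have hpad : M + 0 ≤ m := by rw [add_zero]; exact hMle
  set t : ℕ := K / 2 with ht
  have h2t : 2 * t ≤ K := by rw [ht]; omega
  have hM8 : 8 < M := by nlinarith
  have h4t : 4 * (t + 1) ≤ M := by nlinarith
  -- `#L ≤ m^c ≤ k^{N₀ c} ≤ (k+1)^{N₀ c} ≤ (k+1)^t < (k+1)^{t+1} ≤ C((k+1)(t+1), t+1) ≤ C(M, t+1)`
  have hLM : Fintype.card L < M.choose (t + 1) := by
    have h1 : m ^ c ≤ (k + 1) ^ (N₀ * c) := by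
      calc m ^ c ≤ (k ^ N₀) ^ c := Nat.pow_le_pow_left hmk c
        _ = k ^ (N₀ * c) := by rw [← pow_mul]
        _ ≤ (k + 1) ^ (N₀ * c) := Nat.pow_le_pow_left (Nat.le_succ k) _
    have h2 : (k + 1) ^ (N₀ * c) ≤ (k + 1) ^ t := Nat.pow_le_pow_right (Nat.succ_pos k) (by omega)
    have h3 : (k + 1) ^ t < (k + 1) ^ (t + 1) := Nat.pow_lt_pow_right (by omega) (Nat.lt_succ_self t)
    have h4 : (k + 1) ^ (t + 1) ≤ ((k + 1) * (t + 1)).choose (t + 1) :=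
      Literature.NumberTheory.Primality.SmoothLB.pow_le_choose_mul (k + 1) (t + 1)
    have h5 : ((k + 1) * (t + 1)).choose (t + 1) ≤ M.choose (t + 1) := by
      refine Nat.choose_le_choose (t + 1) ?_
      rw [hM, mul_comm]
      exact Nat.mul_le_mul_right _ (by omega)
    calc Fintype.card L ≤ m ^ c := hL
      _ < M.choose (t + 1) := lt_of_le_of_lt (h1.trans h2) (lt_of_lt_of_le h3 (h4.trans h5))
  -- the coloured block and its column
  set hb : Fin M → Fin K := balCol K (k + 1) with hhb
  have hbal : ∀ c, (cls hb c).card = k + 1 := card_cls_balCol K (k + 1)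
  have hnk : K + 1 ≤ k + 1 := by omega
  set u₀ : Edge m → Bool := padCol (m := m) 0 (colorVec hb) with hu₀
  have hu₀free : cliqueFn m k u₀ = false := by
    have := cliqueFn_padCol hpad (K := K + 1) (by omega) (colorVec hb) (cliqueFn_colorVec hb (Nat.lt_succ_self K))
    rw [hkK]
    simpa using this
  -- the transported family on the block and its symmetry (the extensions fix every vertex `≥ M`, hence `≥ k²`)
  let ext : Equiv.Perm (Fin M) → Equiv.Perm (Fin m) := fun σ =>
    σ.extendDomain (Equiv.ofInjective (liveEmb hpad) (liveEmb hpad).injective)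
  let VM : Finset (Fin M) → L → ℝ := fun P l => V l (P.map (liveEmb hpad))
  let τM : Equiv.Perm (Fin M) → L → L := fun σ => τ (ext σ)
  have hτM : ∀ σ l (P : Finset (Fin M)), VM (P.map σ.toEmbedding) (τM σ l) = VM P l := by
    intro σ l P
    show V (τ (ext σ) l) ((P.map σ.toEmbedding).map (liveEmb hpad)) = V l (P.map (liveEmb hpad))
    rw [map_map_extendDomain hpad σ P]
    refine hτ (ext σ) (fun v hv => extendDomain_apply_of_le hpad σ (by omega)) l (P.map (liveEmb hpad))
  -- the identity restricted to the block
  have hrep : ∀ P : Finset (Fin M), P.card = K + 1 → cdist P (colorVec hb) - ε = ∑ l, U u₀ l * VM P l := by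
    intro P hP
    have hQ : (padRow hpad P).card = k := by rw [card_padRow, hP, hkK]
    have h1 := hall (padRow hpad P) u₀ hQ hu₀free
    rw [hu₀, cdist_pad hpad P (colorVec hb)] at h1
    rw [← hu₀] at h1
    rw [h1, padRow_zero hpad]
  exact cdist_colorVec_not_symmetricRep hb hbal hK2 hnk h2t hM8 h4t hε hLM VM τM hτM
    (fun l P _ => hV l _) (fun l => U u₀ l) (fun l => hU u₀ l) hrep

/-- **The symmetric LP slice of the crux is true (every `δ ∈ (0,1/2)`, every `c`).** Eventually in `m`, for every
`ε > 0`, every index type `L` with `#L ≤ m^c`, every `U ≥ 0`, and every `Sym(m)`-SYMMETRIC family `(V_l)_{l ∈ L}` of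
non-negative row objects (`V_{τ σ l}(σ Q) = V_l(Q)` for all vertex permutations `σ`), the canonical identity
`cdist Q u - ε = ∑_l U_{u,l} V_l(Q)` fails for some `k`-set `Q` (`k = ⌈m^δ⌉₊`) and some `k`-clique-free `u`. (Corollary of the
local form.) [new] -/
theorem symmetric_cliqueDistConeRankHard {δ : ℝ} (hδ0 : 0 < δ) (hδ : δ < 1 / 2) (c : ℕ) :
    ∀ᶠ m : ℕ in atTop, ∀ ε : ℝ, 0 < ε → ∀ (L : Type) [Fintype L], Fintype.card L ≤ m ^ c →
      ∀ (U : (Edge m → Bool) → L → ℝ) (V : L → Finset (Fin m) → ℝ) (τ : Equiv.Perm (Fin m) → L → L),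
      (∀ σ l Q, V (τ σ l) (Q.map σ.toEmbedding) = V l Q) → (∀ u l, 0 ≤ U u l) → (∀ l Q, 0 ≤ V l Q) →
      ¬ ∀ (Q : Finset (Fin m)) (u : Edge m → Bool), Q.card = ⌈(m : ℝ) ^ δ⌉₊ → cliqueFn m ⌈(m : ℝ) ^ δ⌉₊ u = false →
          cdist Q u - ε = ∑ l, U u l * V l Q := by
  filter_upwards [symmetric_cliqueDistConeRankHard_local hδ0 hδ c] with m hm
  intro ε hε L _ hL U V τ hτ hU hV
  exact hm ε hε L hL U V τ (fun σ _ l Q => hτ σ l Q) hU hV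

/-- **Registered helper stub (the symmetric LP slice of the crux holds).** Restatement of
`symmetric_cliqueDistConeRankHard` with all parameters explicit. -/
theorem symmetric_crux : ∀ (δ : ℝ), 0 < δ → δ < 1 / 2 → ∀ c : ℕ, ∀ᶠ m : ℕ in Filter.atTop, ∀ ε : ℝ, 0 < ε → ∀ (L : Type) [Fintype L], Fintype.card L ≤ m ^ c → ∀ (U : (Edge m → Bool) → L → ℝ) (V : L → Finset (Fin m) → ℝ) (τ : Equiv.Perm (Fin m) → L → L), (∀ σ l Q, V (τ σ l) (Q.map σ.toEmbedding) = V l Q) → (∀ u l, 0 ≤ U u l) → (∀ l Q, 0 ≤ V l Q) → ¬ ∀ (Q : Finset (Fin m)) (u : Edge m → Bool), Q.card = ⌈(m : ℝ) ^ δ⌉₊ → cliqueFn m ⌈(m : ℝ) ^ δ⌉₊ u = false → cdist Q u - ε = ∑ l, U u l * V l Q := by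
  intro δ hδ0 hδ c
  exact symmetric_cliqueDistConeRankHard hδ0 hδ c

/-- **Registered helper stub (the LP slice of the crux holds for families symmetric on `k²` vertices).** Restatement of
`symmetric_cliqueDistConeRankHard_local` with all parameters explicit. -/
theorem symmetric_crux_local : ∀ (δ : ℝ), 0 < δ → δ < 1 / 2 → ∀ c : ℕ, ∀ᶠ m : ℕ in Filter.atTop, ∀ ε : ℝ, 0 < ε → ∀ (L : Type) [Fintype L], Fintype.card L ≤ m ^ c → ∀ (U : (Edge m → Bool) → L → ℝ) (V : L → Finset (Fin m) → ℝ) (τ : Equiv.Perm (Fin m) → L → L), (∀ σ : Equiv.Perm (Fin m), (∀ v : Fin m, ⌈(m : ℝ) ^ δ⌉₊ * ⌈(m : ℝ) ^ δ⌉₊ ≤ v.val → σ v = v) → ∀ l Q, V (τ σ l) (Q.map σ.toEmbedding) = V l Q) → (∀ u l, 0 ≤ U u l) → (∀ l Q, 0 ≤ V l Q) → ¬ ∀ (Q : Finset (Fin m)) (u : Edge m → Bool), Q.card = ⌈(m : ℝ) ^ δ⌉₊ → cliqueFn m ⌈(m : ℝ) ^ δ⌉₊ u = false → cdist Q u - ε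 = ∑ l, U u l * V l Q := by
  intro δ hδ0 hδ c
  exact symmetric_cliqueDistConeRankHard_local hδ0 hδ c

end

end Summit.PneNP.PneNP.Theorems
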